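import Mathlib
import Summits.Ventures.PercRepro2.Defs
import Summits.Ventures.PercRepro2.Harris
import Summits.Ventures.PercRepro2.Graph
import Summits.Ventures.PercRepro2.Events
import Summits.Ventures.PercRepro2.BHKAvoidWeighted
import Summits.Ventures.PercRepro2.PsiPendantLemmas

/-!
# The one-edge pinning property (UNI) when `t` is isolated (PercRepro2, p2)

`PsiPinInduction.lean` reduces the (Ψ) inequality of the (PM⁺) line to the one-edge property
(UNI_f): `min (Σ_𝓤(p[f↦0])) (Σ_𝓤(p[f↦1])) ≤ Σ_𝓤(p)` for SOME unpinned edge `f` of every instance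
(`Σ_𝓤` = the multiplied-out (Ψ)-slack `Ug·((q − aH)·oL + q·(oLH + oHH) − aH·oH) − oLU·q²`).  The
`t`-exploration variant of that induction (P2-G17-PSI.md §6.2, §8.3) pins the edges at the explored
`t`-cluster and ends in a regime where the `t`-cluster is deterministic.  This file proves (UNI_f)
for EVERY edge `f` in the simplest such regime — every edge at `t` pinned closed (`t` isolated):
there `Q` is sure, `o ∉ C_t`, the slack collapses to `Ug·(oHH − aH·oH)` (a Harris covariance times an
increasing mass), and along one edge the product-measure covariance is super-linear,
`Cov(w) = (1 − w)·Cov⁰ + w·Cov¹ + w(1 − w)·(aH¹ − aH⁰)(oH¹ − oH⁰)`, so that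
`Σ(w) ≥ ((1 − w)Ug⁰ + wUg¹)((1 − w)Cov⁰ + wCov¹) ≥ min(Σ⁰, Σ¹)` by AM–GM
(`g₀C₁ + g₁C₀ ≥ 2·min(g₀C₀, g₁C₁)` for nonnegative numbers).

* `conn_isolated_eq` — with every edge at `t` closed, `t` is connected only to itself;
* `prob_connEvent_eq_zero_of_isolated` — with every edge at `t` of weight `0`, `P(t ↔ x) = 0` for
  `x ≠ t`;
* `psi_slack_eq_of_isolated` — the collapse of the slack;
* `uni_isolated_algebra` — the pure algebra of the super-linear covariance and AM–GM;
* `psi_uni_of_isolated` — **(UNI_f) for every edge when `t` is isolated**.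
-/

namespace Summit.Ventures.PercRepro2

section Isolated

variable {V : Type*} {E : Type*} [Fintype E] [DecidableEq E] {R : Type*} [CommRing R]
  [LinearOrder R] [IsStrictOrderedRing R]

omit [Fintype E] [DecidableEq E] in
/-- With every edge at `t` closed, `t` is connected only to itself. -/
lemma conn_isolated_eq {ends : E → Sym2 V} {ω : Config E} {t x : V}
    (hclosed : ∀ e, t ∈ ends e → ω e = false) (h : Conn ends ω t x) : x = t := by
  have hS : ∀ a ∈ ({t} : Set V), ∀ b, (openGraph ends ω).Adj a b → b ∈ ({t} : Set V) := by
    intro a ha b hab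
    rw [Set.mem_singleton_iff] at ha
    subst ha
    obtain ⟨_, e, he, hends⟩ := openGraph_adj.1 hab
    have hmem : a ∈ ends e := by rw [hends]; exact Sym2.mem_mk_left a b
    rw [hclosed e hmem] at he
    exact absurd he Bool.false_ne_true
  exact Set.mem_singleton_iff.1 (mem_of_conn_of_closed hS rfl h)

omit [IsStrictOrderedRing R] in
/-- With every edge at `t` of weight `0`, the connection event `{t ↔ x}`, `x ≠ t`, is null. -/
lemma prob_connEvent_eq_zero_of_isolated {p : E → R} (ends : E → Sym2 V) {t x : V}
    (ht : ∀ e, t ∈ ends e → p e = 0) (hx : x ≠ t) : prob p (connEvent ends t x) = 0 := by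
  classical
  unfold prob
  refine Finset.sum_eq_zero fun ω _ => ?_
  by_cases hA : ω ∈ connEvent ends t x
  · rw [Set.indicator_of_mem hA]
    -- some edge at `t` is open in `ω`, and it has weight `0`
    by_contra hne
    have hclosed : ∀ e, t ∈ ends e → ω e = false := by
      intro e he
      by_contra hopen
      have hωe : ω e = true := by
        cases h : ω e
        · exact absurd h hopen
        · rfl
      apply hne
      rw [weight_eq_mul_edgeFactor p ω e, hωe, ht e he]
      simp [edgeFactor]
    exact hx (conn_isolated_eq hclosed hA)
  · rw [Set.indicator_of_notMem hA]

omit [IsStrictOrderedRing R] in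
/-- With every edge at `t` of weight `0`, `Q = {s ↮ t}` is sure (`s ≠ t`). -/
lemma prob_compl_connEvent_eq_one_of_isolated {p : E → R} (ends : E → Sym2 V) {s t : V}
    (ht : ∀ e, t ∈ ends e → p e = 0) (hst : s ≠ t) : prob p (connEvent ends s t)ᶜ = 1 := by
  rw [prob_compl, connEvent_comm, prob_connEvent_eq_zero_of_isolated ends ht hst, sub_zero]

/-- With `Q` sure, intersecting with `Q` changes no probability. -/
lemma prob_inter_compl_connEvent_of_isolated {p : E → R} (hp : IsProbVec p) (ends : E → Sym2 V)
    {s t : V} (ht : ∀ e, t ∈ ends e → p e = 0) (hst : s ≠ t) (A : Set (Config E)) :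
    prob p (A ∩ (connEvent ends s t)ᶜ) = prob p A := by
  have h := prob_inter_add_prob_inter_compl p A (connEvent ends s t)ᶜ
  have h0 : prob p (A ∩ (connEvent ends s t)ᶜᶜ) = 0 := by
    apply le_antisymm _ (prob_nonneg hp _)
    rw [compl_compl]
    calc prob p (A ∩ connEvent ends s t) ≤ prob p (connEvent ends s t) :=
          prob_mono hp Set.inter_subset_right
      _ = 0 := by rw [connEvent_comm]; exact prob_connEvent_eq_zero_of_isolated ends ht hst
  rw [h0, add_zero] at h
  exact h

/-- With every edge at `t` of weight `0`, `{o ∈ C_t}` (`o ≠ t`) is null, also after intersecting. -/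
lemma prob_inter_clusterInEvent_t_eq_zero_of_isolated {p : E → R} (hp : IsProbVec p)
    (ends : E → Sym2 V) {t o : V} (ht : ∀ e, t ∈ ends e → p e = 0) (hot : o ≠ t)
    (A : Set (Config E)) :
    prob p (A ∩ clusterInEvent ends t {W : Set V | o ∈ W}) = 0 := by
  apply le_antisymm _ (prob_nonneg hp _)
  calc prob p (A ∩ clusterInEvent ends t {W : Set V | o ∈ W})
      ≤ prob p (clusterInEvent ends t {W : Set V | o ∈ W}) := prob_mono hp Set.inter_subset_right
    _ = 0 := by
        rw [clusterInEvent_memFamily_eq_connEvent]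
        exact prob_connEvent_eq_zero_of_isolated ends ht hot

end Isolated

section Algebra

variable {R : Type*} [CommRing R] [LinearOrder R] [IsStrictOrderedRing R]

/-- `g₀C₁ + g₁C₀ ≥ 2·min(g₀C₀, g₁C₁)` for nonnegative numbers (AM–GM). -/
lemma two_min_le_cross {g0 g1 C0 C1 : R} (hg0 : 0 ≤ g0) (hg1 : 0 ≤ g1) (hC0 : 0 ≤ C0)
    (hC1 : 0 ≤ C1) : 2 * min (g0 * C0) (g1 * C1) ≤ g0 * C1 + g1 * C0 := by
  have hX : 0 ≤ g0 * C1 + g1 * C0 := add_nonneg (mul_nonneg hg0 hC1) (mul_nonneg hg1 hC0)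
  have hsq : 4 * ((g0 * C0) * (g1 * C1)) ≤ (g0 * C1 + g1 * C0) ^ 2 := by
    nlinarith [sq_nonneg (g0 * C1 - g1 * C0)]
  rcases le_total (g0 * C0) (g1 * C1) with hle | hle
  · rw [min_eq_left hle]
    have hm : 0 ≤ g0 * C0 := mul_nonneg hg0 hC0
    have h4 : (2 * (g0 * C0)) ^ 2 ≤ (g0 * C1 + g1 * C0) ^ 2 := by
      nlinarith [mul_le_mul_of_nonneg_left hle hm, hsq]
    by_contra hcon
    have hlt := mul_self_lt_mul_self hX (not_le.1 hcon)
    nlinarith [hlt, h4]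
  · rw [min_eq_right hle]
    have hm : 0 ≤ g1 * C1 := mul_nonneg hg1 hC1
    have h4 : (2 * (g1 * C1)) ^ 2 ≤ (g0 * C1 + g1 * C0) ^ 2 := by
      nlinarith [mul_le_mul_of_nonneg_left hle hm, hsq]
    by_contra hcon
    have hlt := mul_self_lt_mul_self hX (not_le.1 hcon)
    nlinarith [hlt, h4]

/-- The algebra of (UNI_f) in the isolated regime: super-linear covariance and AM–GM. -/
lemma uni_isolated_algebra {w g0 g1 a0 a1 h0 h1 x0 x1 : R} (hw : 0 ≤ w) (hw1 : w ≤ 1)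
    (hg0 : 0 ≤ g0) (hg1 : 0 ≤ g1) (ha : a0 ≤ a1) (hh : h0 ≤ h1)
    (c0 : a0 * h0 ≤ x0) (c1 : a1 * h1 ≤ x1) :
    min (g0 * (x0 - a0 * h0)) (g1 * (x1 - a1 * h1)) ≤
      (w * g1 + (1 - w) * g0) *
        ((w * x1 + (1 - w) * x0) - (w * a1 + (1 - w) * a0) * (w * h1 + (1 - w) * h0)) := by
  set C0 := x0 - a0 * h0 with hC0def
  set C1 := x1 - a1 * h1 with hC1def
  have hC0 : 0 ≤ C0 := sub_nonneg.2 c0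
  have hC1 : 0 ≤ C1 := sub_nonneg.2 c1
  have hcross := two_min_le_cross hg0 hg1 hC0 hC1
  have hmin0 : min (g0 * C0) (g1 * C1) ≤ g0 * C0 := min_le_left _ _
  have hmin1 : min (g0 * C0) (g1 * C1) ≤ g1 * C1 := min_le_right _ _
  have hsuper : 0 ≤ w * (1 - w) * ((a1 - a0) * (h1 - h0)) :=
    mul_nonneg (mul_nonneg hw (sub_nonneg.2 hw1))
      (mul_nonneg (sub_nonneg.2 ha) (sub_nonneg.2 hh))
  have hg : 0 ≤ w * g1 + (1 - w) * g0 :=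
    add_nonneg (mul_nonneg hw hg1) (mul_nonneg (sub_nonneg.2 hw1) hg0)
  have hbr : (w * x1 + (1 - w) * x0) - (w * a1 + (1 - w) * a0) * (w * h1 + (1 - w) * h0) =
      w * C1 + (1 - w) * C0 + w * (1 - w) * ((a1 - a0) * (h1 - h0)) := by
    rw [hC0def, hC1def]; ring
  rw [hbr]
  have e1 := mul_le_mul_of_nonneg_left (le_add_of_nonneg_right hsuper : w * C1 + (1 - w) * C0 ≤
    w * C1 + (1 - w) * C0 + w * (1 - w) * ((a1 - a0) * (h1 - h0))) hg
  refine le_trans ?_ e1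
  nlinarith [mul_nonneg (mul_nonneg hw (sub_nonneg.2 hw1)) (sub_nonneg.2 hcross),
    mul_nonneg (mul_nonneg hw hw) (sub_nonneg.2 hmin1),
    mul_nonneg (mul_nonneg (sub_nonneg.2 hw1) (sub_nonneg.2 hw1)) (sub_nonneg.2 hmin0)]

end Algebra

section UniIsolated

variable {V : Type*} {E : Type*} [Fintype E] [DecidableEq E]
  {R : Type*} [CommRing R] [LinearOrder R] [IsStrictOrderedRing R]

/-- In the isolated regime the (Ψ)-slack collapses to `Ug·(oHH − aH·oH)` (no `Q`, no `o ∈ C_t`). -/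
lemma psi_slack_eq_of_isolated (p : E → R) (hp : IsProbVec p) (ends : E → Sym2 V)
    (s t o u : V) (ht : ∀ e, t ∈ ends e → p e = 0) (hst : s ≠ t) (hot : o ≠ t)
    (𝓤 : Set (Set V)) :
    (prob p (clusterInEvent ends s 𝓤 ∩ (connEvent ends s t)ᶜ) *
        ((prob p (connEvent ends s t)ᶜ - prob p (connEvent ends s u ∩ (connEvent ends s t)ᶜ)) *
            prob p (clusterInEvent ends t {W : Set V | o ∈ W} ∩ (connEvent ends s t)ᶜ) +
          prob p (connEvent ends s t)ᶜ *
            (prob p (connEvent ends s u ∩ clusterInEvent ends t {W : Set V | o ∈ W} ∩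
          (connEvent ends s t)ᶜ) +
              prob p (connEvent ends s u ∩ clusterInEvent ends s {W : Set V | o ∈ W} ∩
          (connEvent ends s t)ᶜ)) -
          prob p (connEvent ends s u ∩ (connEvent ends s t)ᶜ) *
            prob p (clusterInEvent ends s {W : Set V | o ∈ W} ∩ (connEvent ends s t)ᶜ)) -
      prob p (clusterInEvent ends s 𝓤 ∩ clusterInEvent ends t {W : Set V | o ∈ W} ∩
          (connEvent ends s t)ᶜ) * prob p (connEvent ends s t)ᶜ * prob p (connEvent ends s t)ᶜ) =
      prob p (clusterInEvent ends s 𝓤) *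
        (prob p (connEvent ends s u ∩ clusterInEvent ends s {W : Set V | o ∈ W}) -
          prob p (connEvent ends s u) * prob p (clusterInEvent ends s {W : Set V | o ∈ W})) := by
  rw [prob_compl_connEvent_eq_one_of_isolated ends ht hst]
  simp only [prob_inter_compl_connEvent_of_isolated hp ends ht hst]
  rw [prob_inter_clusterInEvent_t_eq_zero_of_isolated hp ends ht hot,
    prob_inter_clusterInEvent_t_eq_zero_of_isolated hp ends ht hot]
  have h0 : prob p (clusterInEvent ends t {W : Set V | o ∈ W}) = 0 := by
    have := prob_inter_clusterInEvent_t_eq_zero_of_isolated hp ends ht hot Set.univ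
    rwa [Set.univ_inter] at this
  rw [h0]
  ring

/-- **(UNI_f) for every edge when `t` is isolated.** If every edge at `t` has weight `0`
(`s, o ≠ t`) and `𝓤` is an up-set, then for every edge `f` the (Ψ)-slack under `p` dominates the
smaller of its values with `f` pinned closed / open. -/
theorem psi_uni_of_isolated (p : E → R) (hp : IsProbVec p) (ends : E → Sym2 V) (s t o u : V)
    (ht : ∀ e, t ∈ ends e → p e = 0) (hst : s ≠ t) (hot : o ≠ t) {𝓤 : Set (Set V)}
    (h𝓤 : IsUpperSet 𝓤) (f : E) :
    min (prob (Function.update p f 0) (clusterInEvent ends s 𝓤 ∩ (connEvent ends s t)ᶜ) *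
        ((prob (Function.update p f 0) (connEvent ends s t)ᶜ - prob (Function.update p f 0) (connEvent ends s u ∩ (connEvent ends s t)ᶜ)) *
            prob (Function.update p f 0) (clusterInEvent ends t {W : Set V | o ∈ W} ∩ (connEvent ends s t)ᶜ) +
          prob (Function.update p f 0) (connEvent ends s t)ᶜ *
            (prob (Function.update p f 0) (connEvent ends s u ∩ clusterInEvent ends t {W : Set V | o ∈ W} ∩
          (connEvent ends s t)ᶜ) +
              prob (Function.update p f 0) (connEvent ends s u ∩ clusterInEvent ends s {W : Set V | o ∈ W} ∩
          (connEvent ends s t)ᶜ)) -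
          prob (Function.update p f 0) (connEvent ends s u ∩ (connEvent ends s t)ᶜ) *
            prob (Function.update p f 0) (clusterInEvent ends s {W : Set V | o ∈ W} ∩ (connEvent ends s t)ᶜ)) -
      prob (Function.update p f 0) (clusterInEvent ends s 𝓤 ∩ clusterInEvent ends t {W : Set V | o ∈ W} ∩
          (connEvent ends s t)ᶜ) * prob (Function.update p f 0) (connEvent ends s t)ᶜ * prob (Function.update p f 0) (connEvent ends s t)ᶜ) (prob (Function.update p f 1) (clusterInEvent ends s 𝓤 ∩ (connEvent ends s t)ᶜ) *
        ((prob (Function.update p f 1) (connEvent ends s t)ᶜ - prob (Function.update p f 1) (connEvent ends s u ∩ (connEvent ends s t)ᶜ)) *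
            prob (Function.update p f 1) (clusterInEvent ends t {W : Set V | o ∈ W} ∩ (connEvent ends s t)ᶜ) +
          prob (Function.update p f 1) (connEvent ends s t)ᶜ *
            (prob (Function.update p f 1) (connEvent ends s u ∩ clusterInEvent ends t {W : Set V | o ∈ W} ∩
          (connEvent ends s t)ᶜ) +
              prob (Function.update p f 1) (connEvent ends s u ∩ clusterInEvent ends s {W : Set V | o ∈ W} ∩
          (connEvent ends s t)ᶜ)) -
          prob (Function.update p f 1) (connEvent ends s u ∩ (connEvent ends s t)ᶜ) *
            prob (Function.update p f 1) (clusterInEvent ends s {W : Set V | o ∈ W} ∩ (connEvent ends s t)ᶜ)) -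
      prob (Function.update p f 1) (clusterInEvent ends s 𝓤 ∩ clusterInEvent ends t {W : Set V | o ∈ W} ∩
          (connEvent ends s t)ᶜ) * prob (Function.update p f 1) (connEvent ends s t)ᶜ * prob (Function.update p f 1) (connEvent ends s t)ᶜ) ≤ (prob p (clusterInEvent ends s 𝓤 ∩ (connEvent ends s t)ᶜ) *
        ((prob p (connEvent ends s t)ᶜ - prob p (connEvent ends s u ∩ (connEvent ends s t)ᶜ)) *
            prob p (clusterInEvent ends t {W : Set V | o ∈ W} ∩ (connEvent ends s t)ᶜ) +
          prob p (connEvent ends s t)ᶜ *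
            (prob p (connEvent ends s u ∩ clusterInEvent ends t {W : Set V | o ∈ W} ∩
          (connEvent ends s t)ᶜ) +
              prob p (connEvent ends s u ∩ clusterInEvent ends s {W : Set V | o ∈ W} ∩
          (connEvent ends s t)ᶜ)) -
          prob p (connEvent ends s u ∩ (connEvent ends s t)ᶜ) *
            prob p (clusterInEvent ends s {W : Set V | o ∈ W} ∩ (connEvent ends s t)ᶜ)) -
      prob p (clusterInEvent ends s 𝓤 ∩ clusterInEvent ends t {W : Set V | o ∈ W} ∩
          (connEvent ends s t)ᶜ) * prob p (connEvent ends s t)ᶜ * prob p (connEvent ends s t)ᶜ) := by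
  have hw : 0 ≤ p f := hp.nonneg f
  have hw1 : p f ≤ 1 := hp.le_one f
  have hp0 : IsProbVec (Function.update p f 0) := hp.update f le_rfl zero_le_one
  have hp1 : IsProbVec (Function.update p f 1) := hp.update f zero_le_one le_rfl
  by_cases hf : t ∈ ends f
  · -- `f` is an edge at `t`: its weight is already `0`, so `p = p[f↦0]` and the claim is trivial
    have hpf : Function.update p f 0 = p := by
      rw [← ht f hf]; exact Function.update_eq_self f p
    rw [hpf]
    exact min_le_left _ _
  have hef : ∀ e, t ∈ ends e → e ≠ f := fun e he h => hf (by rw [← h]; exact he)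
  have ht0 : ∀ e, t ∈ ends e → Function.update p f 0 e = 0 := fun e he => by
    rw [Function.update_of_ne (hef e he), ht e he]
  have ht1 : ∀ e, t ∈ ends e → Function.update p f 1 e = 0 := fun e he => by
    rw [Function.update_of_ne (hef e he), ht e he]
  rw [psi_slack_eq_of_isolated p hp ends s t o u ht hst hot 𝓤,
    psi_slack_eq_of_isolated _ hp0 ends s t o u ht0 hst hot 𝓤,
    psi_slack_eq_of_isolated _ hp1 ends s t o u ht1 hst hot 𝓤]
  -- the four masses mix along `f`; the increasing ones grow with `f`; Harris at both ends
  have hUU : IsUpperSet (clusterInEvent ends s 𝓤) := isUpperSet_clusterInEvent ends s h𝓤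
  have hAU : IsUpperSet (connEvent ends s u) := isUpperSet_connEvent ends s u
  have hOH : IsUpperSet (clusterInEvent ends s {W : Set V | o ∈ W}) :=
    isUpperSet_clusterInEvent ends s (isUpperSet_memFamily o)
  have mono : ∀ {A : Set (Config E)}, IsUpperSet A →
      prob (Function.update p f 0) A ≤ prob (Function.update p f 1) A := fun hA =>
    prob_update_zero_le_prob_update_one hp f (fun ω hω => hA (update_false_le_update_true ω f) hω)
  have eU := prob_eq_pin p (clusterInEvent ends s 𝓤) f
  have eA := prob_eq_pin p (connEvent ends s u) f
  have eO := prob_eq_pin p (clusterInEvent ends s {W : Set V | o ∈ W}) f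
  have eX := prob_eq_pin p (connEvent ends s u ∩ clusterInEvent ends s {W : Set V | o ∈ W}) f
  rw [eU, eA, eO, eX]
  exact uni_isolated_algebra hw hw1 (prob_nonneg hp0 _) (prob_nonneg hp1 _) (mono hAU) (mono hOH)
    (prob_mul_prob_le_prob_inter hp0 hAU hOH) (prob_mul_prob_le_prob_inter hp1 hAU hOH)

end UniIsolated

end Summit.Ventures.PercRepro2
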